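import Literature.Geometry.Lorentzian.StabilityOfMinimizersFlow
import HarnessLib

/-!
# The first variation of area vanishes on area-minimising immersed surfaces (divergence form)

Schoen–Yau, Comm. Math. Phys. 65 (1979), §2, Step 2 works with "a complete area minimizing
surface" `S` (p. 49) and Plateau solutions `S_σ`, and uses, besides stability (2.13), the
*first-order* consequences of minimality: comparison of areas ((2.9), p. 52; (2.22)–(2.25),
pp. 56–57) and the monotonicity-type inequality `A(Σ ∩ B_r(x₀)) ≥ π r²` ("A well-known
inequality (see [15])", p. 56). In the smooth-deformation framework of
`StabilityOfMinimizersFlow.lean` (`SurfaceVariation.IsAreaMinimizingOn`: area does not decrease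
under compactly supported smooth deformations through immersions) the basic first-order statement
is the vanishing of the first variation of area in divergence form (Lawson 1980, Ch. I, Thm. 7.1;
Simons 1968, §3.2): for every compactly supported smooth ambient vector field `V`,
`∫_K div_S V dμ = 0`, where `div_S V = ∑ᵢ h(D_{βᵢ}(V ∘ F₀), dF₀ βᵢ)` in an orthonormal frame `β`
of the induced metric — the identity from which the monotonicity formula is derived by testing
with radial fields (Simon 1983, §17). This file proves it:

* `SurfaceVariation.setIntegral_firstVariation_eq_zero_of_isLocalMin` — for a smooth family of
  immersions `F` and a compact `K` on which `t ↦ μ_{F_t^*h}(K)` has a local minimum at `t₀`,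
  `∫_K ∑ᵢ h(D_{βᵢ} E, dF_{t₀} βᵢ) dμ_{t₀} = 0` for the variation field `E = ∂ₜF(t₀, ·)` and any
  field of orthonormal frames `β` (Fermat's condition with `hasDerivAt_areaOn` and the first
  variation integrand `densityDeriv_eq_of_orthonormal`);
* `SurfaceVariation.setIntegral_tangentialDivergence_eq_zero_of_isAreaMinimizingOn` — **first
  variation, divergence form**: for an immersion `F₀ : S → X` into a Hausdorff Riemannian
  `3`-manifold, area-minimising on the compact `K`, and a smooth
  ambient field `V` with compact support such that `V ∘ F₀` vanishes off a compact subset of the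
  interior of `K`: `∫_K ∑ᵢ h(D_{βᵢ}(V ∘ F₀), dF₀ βᵢ) dμ = 0` (the family is `Ψ_t ∘ F₀` for the
  flow `Ψ` of `V`, `uflowIsotopy`; its variation field is `V ∘ F₀`, `tvelocity_isotopy_comp`).

Everything is proved; no definitions, no named facts.

## References

* R. Schoen, S.-T. Yau, Comm. Math. Phys. 65 (1979) 45–76, §2, Step 2, p. 49, (2.9), and
  pp. 56–57. [SchoenYauPMT1979]
* H. B. Lawson, *Lectures on minimal submanifolds*, Vol. I, Publish or Perish 1980, Ch. I §7,
  Thm. 7.1 (first variation formula).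
* J. Simons, *Minimal varieties in riemannian manifolds*, Ann. of Math. 88 (1968) 62–105, §3.2.
* L. Simon, *Lectures on geometric measure theory*, ANU 1983, §§16–17.
-/

noncomputable section

open Bundle Set Manifold TopologicalSpace Filter Function MeasureTheory
open scoped ContDiff Topology Manifold Matrix ENNReal

namespace Literature.Geometry.Lorentzian

open PseudoRiemannianMetric Literature.Topology.FourManifolds

namespace SurfaceVariation

variable {X : Type*} [TopologicalSpace X] [ChartedSpace E3 X] [IsManifold (𝓡 3) ∞ X]
  {h : ContMDiffRiemannianMetric (𝓡 3) ∞ E3 (TangentSpace (𝓡 3) : X → Type _)}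
  [(ofRiemannian h).HasLeviCivita]
  {S : Type*} [TopologicalSpace S] [ChartedSpace (EuclideanSpace ℝ (Fin 2)) S]
  [IsManifold (𝓡 2) ∞ S] [T3Space S] [SecondCountableTopology S] [MeasurableSpace S] [BorelSpace S]

/-! ### The first-order condition for a family -/

/-- **First variation of area at a local minimum (family form).** Let `F : ℝ → S → X` be a smooth
family of immersions of the surface `S` into the Riemannian `3`-manifold `(X, h)` and `K ⊆ S`
compact such that `t ↦ μ_{F_t^*h}(K)` has a local minimum at `t₀`. Then for every field `β` of
`(F_{t₀}^*h)`-orthonormal frames of `TS` the first variation integrand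
`∑ᵢ h(D_{βᵢ} E, dF_{t₀} βᵢ)` (`E = ∂ₜF(t₀, ·)`, the tangential divergence of the variation field) is
integrable on `K` and `∫_K ∑ᵢ h(D_{βᵢ} E, dF_{t₀} βᵢ) dμ_{t₀} = 0` (Fermat's condition for
`A_K(t) = μ_t(K)`, differentiable with `A_K'(t₀) = ∫_K ∂ₜ(dμ_t/dμ_{t₀})`, `hasDerivAt_areaOn`, and
`∂ₜ(dμ_t/dμ_{t₀})|_{t₀} = ∑ᵢ h(D_{βᵢ} E, dF βᵢ)`, `densityDeriv_eq_of_orthonormal`). Lawson 1980,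
Ch. I, Thm. 7.1. [cite: SchoenYauPMT1979, §2, Step 2, p. 49] -/
theorem setIntegral_firstVariation_eq_zero_of_isLocalMin {F : ℝ → S → X}
    {hpb : contMDiff_pullbackBilin (𝓡 3) X (𝓡 2) S ∞}
    {himm : ∀ t, (ofRiemannian h).IsSpacelikeImmersion (𝓡 2) (F t)}
    (hF : ContMDiff (𝓘(ℝ, ℝ).prod (𝓡 2)) (𝓡 3) ∞ (fun q : ℝ × S ↦ F q.1 q.2)) (t₀ : ℝ)
    {K : Set S} (hK : IsCompact K) (hmin : IsLocalMin (areaOn hpb himm K) t₀)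
    (β : Π p : S, Module.Basis (Fin 2) ℝ (TangentSpace (𝓡 2) p))
    (hβ : ∀ p i j, (ofRiemannian h).val (F t₀ p) (mfderiv (𝓡 2) (𝓡 3) (F t₀) p (β p i))
      (mfderiv (𝓡 2) (𝓡 3) (F t₀) p (β p j)) = if i = j then 1 else 0) :
    Integrable (fun p ↦ ∑ i, (ofRiemannian h).val (F t₀ p)
        ((ofRiemannian h).normalDerivAlong (F t₀) (tvelocity (𝓡 3) F t₀) p (β p i))
        (mfderiv (𝓡 2) (𝓡 3) (F t₀) p (β p i)))
      ((riemannianMeasure (metricAt hpb himm t₀)).restrict K) ∧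
    ∫ p in K, ∑ i, (ofRiemannian h).val (F t₀ p)
        ((ofRiemannian h).normalDerivAlong (F t₀) (tvelocity (𝓡 3) F t₀) p (β p i))
        (mfderiv (𝓡 2) (𝓡 3) (F t₀) p (β p i)) ∂riemannianMeasure (metricAt hpb himm t₀) = 0 := by
  obtain ⟨hint, hA⟩ := hasDerivAt_areaOn (hpb := hpb) (himm := himm) hF t₀ hK t₀
  have h1st : ∫ p in K, densityDeriv hpb himm t₀ t₀ p ∂riemannianMeasure (metricAt hpb himm t₀) = 0 :=
    hmin.hasDerivAt_eq_zero hA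
  have hfun : (fun p ↦ densityDeriv hpb himm t₀ t₀ p) = fun p ↦ ∑ i, (ofRiemannian h).val (F t₀ p)
      ((ofRiemannian h).normalDerivAlong (F t₀) (tvelocity (𝓡 3) F t₀) p (β p i))
      (mfderiv (𝓡 2) (𝓡 3) (F t₀) p (β p i)) :=
    funext fun p ↦ densityDeriv_eq_of_orthonormal hF t₀ p (β p) (hβ p)
  rw [hfun] at hint h1st
  exact ⟨hint, h1st⟩

/-! ### The first variation along the flow of an ambient vector field -/

variable [T2Space X]

set_option maxHeartbeats 400000 in
/-- **The first variation of area vanishes on an area-minimising immersion, divergence form.**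
Let `F₀ : S → X` be an immersion of a surface into a Hausdorff Riemannian `3`-manifold `(X, h)`
which is area-minimising on the compact set `K ⊆ S` under compactly
supported smooth deformations (`IsAreaMinimizingOn`), let `V` be a smooth vector field on `X`
vanishing off a compact set `C`, such that `V ∘ F₀` vanishes off a compact subset `K'` of the
interior of `K`, and let `β` be a field of `(F₀^*h)`-orthonormal frames of `TS`. Then the tangential
divergence `div_S V = ∑ᵢ h(D_{βᵢ}(V ∘ F₀), dF₀ βᵢ)` is integrable on `K` and
`∫_K ∑ᵢ h(D_{βᵢ}(V ∘ F₀), dF₀ βᵢ) dμ_{F₀^*h} = 0`. Proof: the flow `Ψ` of `V` (Hirsch 1976,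
Ch. 8 §1, Thm. 1.2, `uflowIsotopy`) gives the smooth family of immersions `t ↦ Ψ_t ∘ F₀` through
`F₀`, static off `K'` (zeros of `V` do not move), with variation field `V ∘ F₀`
(`tvelocity_isotopy_comp`); its area of `K` is minimal at `t = 0` by hypothesis, and
`setIntegral_firstVariation_eq_zero_of_isLocalMin` applies. Lawson 1980, Ch. I, Thm. 7.1 ("the
first variation formula"; minimal ⇔ critical for area); this is the identity behind (2.9) and the
monotonicity inequality of Schoen–Yau 1979, §2, Step 2 and pp. 56–57.
[cite: SchoenYauPMT1979, §2, Step 2, p. 49 and (2.9), p. 52] -/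
theorem setIntegral_tangentialDivergence_eq_zero_of_isAreaMinimizingOn {F₀ : S → X}
    {hpb : contMDiff_pullbackBilin (𝓡 3) X (𝓡 2) S ∞}
    (hfi : (ofRiemannian h).IsSpacelikeImmersion (𝓡 2) F₀)
    {V : Π x : X, TangentSpace (𝓡 3) x}
    (hV : ContMDiff (𝓡 3) (𝓡 3).tangent ∞
      (fun x ↦ (TotalSpace.mk' E3 x (V x) : TangentBundle (𝓡 3) X)))
    {C : Set X} (hC : IsCompact C) (hVC : ∀ x, x ∉ C → V x = 0)
    {K K' : Set S} (hK : IsCompact K) (hK' : IsCompact K') (hK'K : K' ⊆ interior K)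
    (hstat : ∀ y, y ∉ K' → V (F₀ y) = 0)
    (harea : IsAreaMinimizingOn (h := h) hpb F₀ K)
    (β : Π p : S, Module.Basis (Fin 2) ℝ (TangentSpace (𝓡 2) p))
    (hβ : ∀ p i j, (ofRiemannian h).val (F₀ p) (mfderiv (𝓡 2) (𝓡 3) F₀ p (β p i))
      (mfderiv (𝓡 2) (𝓡 3) F₀ p (β p j)) = if i = j then 1 else 0) :
    Integrable (fun p ↦ ∑ i, (ofRiemannian h).val (F₀ p)
        ((ofRiemannian h).normalDerivAlong F₀ (fun y ↦ V (F₀ y)) p (β p i))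
        (mfderiv (𝓡 2) (𝓡 3) F₀ p (β p i)))
      ((riemannianMeasure ((ofRiemannian h).inducedRiemannianMetric F₀ hpb hfi)).restrict K) ∧
    ∫ p in K, ∑ i, (ofRiemannian h).val (F₀ p)
        ((ofRiemannian h).normalDerivAlong F₀ (fun y ↦ V (F₀ y)) p (β p i))
        (mfderiv (𝓡 2) (𝓡 3) F₀ p (β p i))
      ∂riemannianMeasure ((ofRiemannian h).inducedRiemannianMetric F₀ hpb hfi) = 0 := by
  unfold IsAreaMinimizingOn at harea
  -- the flow of `V` and the family `t ↦ Ψ_t ∘ F₀`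
  obtain ⟨ε, hε, hu⟩ := hasUniformLocalFlow_of_isCompact_support hV hC hC.isClosed hVC
  set Ψ := uflowIsotopy hV hε hu with hΨ
  have hΨV : ∀ x, IsMIntegralCurve (fun t ↦ Ψ.toFun t x) V := isMIntegralCurve_uflowIsotopy hV hε hu
  set F : ℝ → S → X := fun t y ↦ Ψ.toFun t (F₀ y) with hFdef
  have hFs : ContMDiff (𝓘(ℝ, ℝ).prod (𝓡 2)) (𝓡 3) ∞ (fun q : ℝ × S ↦ F q.1 q.2) :=
    contMDiff_isotopy_comp Ψ hfi.contMDiff_self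
  have himm : ∀ t, (ofRiemannian h).IsSpacelikeImmersion (𝓡 2) (F t) :=
    fun t ↦ isSpacelikeImmersion_isotopy_comp Ψ hfi t
  have hF0 : F 0 = F₀ := isotopy_comp_zero Ψ
  -- the variation field is `V ∘ F₀`
  have hvel : ∀ y, (tvelocity (𝓡 3) F 0 y : E3) = V (F₀ y) := by
    intro y
    rw [tvelocity_isotopy_comp Ψ hΨV 0 y]
    have key : ∀ x, x = F₀ y → (V x : E3) = V (F₀ y) := by rintro x rfl; rfl
    exact key _ (by simp [hΨ])
  -- static off `K'`
  have hstatF : ∀ t y, y ∉ K' → F t y = F₀ y := fun t y hy ↦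
    uflowIsotopy_apply_of_eq_zero hV hε hu (hstat y hy) t
  -- local minimality of the area of `K` at `t = 0`
  have hminF : IsLocalMin (areaOn hpb himm K) 0 := by
    have hle : ∀ t, riemannianMeasure ((ofRiemannian h).inducedRiemannianMetric (F 0) hpb (himm 0)) K ≤
        riemannianMeasure ((ofRiemannian h).inducedRiemannianMetric (F t) hpb (himm t)) K :=
      harea F hFs himm hF0 ⟨K', hK', hK'K, hstatF⟩
    refine Filter.Eventually.of_forall fun t ↦ ?_
    exact ENNReal.toReal_mono
      (riemannianMeasure_lt_top_of_isCompact (hpb := hpb) (himm := himm) t hK).ne (hle t)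
  -- the induced metrics (hence measures) of `F 0` and `F₀` agree
  have hmetric : metricAt hpb himm 0 = (ofRiemannian h).inducedRiemannianMetric F₀ hpb hfi := by
    have key : ∀ (f₁ : S → X) (h₁ : (ofRiemannian h).IsSpacelikeImmersion (𝓡 2) f₁), f₁ = F₀ →
        (ofRiemannian h).inducedRiemannianMetric f₁ hpb h₁ =
          (ofRiemannian h).inducedRiemannianMetric F₀ hpb hfi := by
      rintro f₁ h₁ rfl; rfl
    exact key (F 0) (himm 0) hF0
  -- orthonormality of `β` for `F 0`
  have hβ0 : ∀ p i j, (ofRiemannian h).val (F 0 p) (mfderiv (𝓡 2) (𝓡 3) (F 0) p (β p i))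
      (mfderiv (𝓡 2) (𝓡 3) (F 0) p (β p j)) = if i = j then 1 else 0 := by
    rw [hF0]; exact hβ
  obtain ⟨hint, hzero⟩ := setIntegral_firstVariation_eq_zero_of_isLocalMin (hpb := hpb)
    (himm := himm) hFs 0 hK hminF β hβ0
  -- transport the integrand from `F 0`, `∂ₜF(0,·)` to `F₀`, `V ∘ F₀`
  have hpt : ∀ p, ∑ i, (ofRiemannian h).val (F 0 p)
      ((ofRiemannian h).normalDerivAlong (F 0) (tvelocity (𝓡 3) F 0) p (β p i))
      (mfderiv (𝓡 2) (𝓡 3) (F 0) p (β p i)) =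
      ∑ i, (ofRiemannian h).val (F₀ p)
        ((ofRiemannian h).normalDerivAlong F₀ (fun y ↦ V (F₀ y)) p (β p i))
        (mfderiv (𝓡 2) (𝓡 3) F₀ p (β p i)) :=
    fun p ↦ sum_val_normalDerivAlong_congr (h := h) hF0 hvel p (β p)
  have hfun : (fun p ↦ ∑ i, (ofRiemannian h).val (F 0 p)
      ((ofRiemannian h).normalDerivAlong (F 0) (tvelocity (𝓡 3) F 0) p (β p i))
      (mfderiv (𝓡 2) (𝓡 3) (F 0) p (β p i))) =
      fun p ↦ ∑ i, (ofRiemannian h).val (F₀ p)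
        ((ofRiemannian h).normalDerivAlong F₀ (fun y ↦ V (F₀ y)) p (β p i))
        (mfderiv (𝓡 2) (𝓡 3) F₀ p (β p i)) := funext hpt
  rw [hfun, hmetric] at hint
  rw [hfun, hmetric] at hzero
  exact ⟨hint, hzero⟩

end SurfaceVariation

end Literature.Geometry.Lorentzian

end
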